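import Mathlib
import Summits.ValiantsHypothesis.ValiantsHypothesis.Theorems.FifoMatchingNFPolytopeQueueGridCorProjection
import Summits.ValiantsHypothesis.ValiantsHypothesis.Theorems.FifoMatchingNFPolytopeQuasiPolyXCOfQueueGrid
import Literature.Combinatorics.Optimization.CorrelationPolytopeGridMinor
import HarnessLib

/-!
# K1 input (B) discharged from the Literature fact `AboulkerEtAl2019_corGridMinor`

Assembly file (c1 g5, K1 closer hand per director-valiant R157 (a)) for the support item stmt-ValiantsHypothesis-26254
(`Theses.FifoMatching.NFPolytopeQuasiPolyXC`, K1; line `Cruxes/NNLinearDegreeCofactorHard/Lines/queue_grid_face.lean`).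
Honesty: K1 open → open — what is proved here is (B) from ONE named print fact, and «K1-body ⇐ (A) ∧ fact»; input (A)
(`queueGridFaceProjection`, qg1 g0, kernel-clean, landing as `…QueueGridFaceProjection.lean`) is still a hypothesis here;
HD-1 / `NNDivisionHard` untouched; stmt-23918 / 24468 CLOSED, untouched; VP ≠ VNP is not moved.

* `corVec_eq_corVertex`, `corPolytopeGraph_eq` — the Literature module's `corVec` / `corPolytopeGraph`
  (`Literature/Combinatorics/Optimization/CorrelationPolytopeGridMinor.lean`, val-lit-p9, p615264) agree with the copies
  `QueueGridFace.corVertex` / `QueueGridFace.corPolytopeGraph` of `…QueueGridCorProjection.lean` (p615220);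
* `queueGridPPHard_of_AboulkerEtAl2019` — INPUT (B) of the line (the body of `QueueGridPPHard`) from the named fact
  `Literature.Combinatorics.Optimization.AboulkerEtAl2019_corGridMinor` (Aboulker–Fiorini–Huynh–Macchia–Seif 2019,
  Theorem 6 / remark p. 4) via its grid instance `.grid` and `queueGridPPHard_of_corGridBound`;
* `newtXC_of_faceProjection_of_AboulkerEtAl2019` — the BODY of K1 from (A) (hypothesis) and the fact, via
  `newtXC_of_inputs` (p615400).  The closer proper (the route decl by name, which inlines `newt`/`NN_n` verbatim) is the
  one-line `exact` of this in a file importing `Theses.FifoMatching` and qg1's `queueGridFaceProjection`.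
-/

-- Sub = Summit single-conjunct layout: the duplicated namespace component is mandated by the tree.
set_option linter.dupNamespace false

namespace Summit.ValiantsHypothesis.ValiantsHypothesis.Theorems.FifoMatching.QueueGridFace

open Literature.Barriers.PneNP Literature.Computability.MetaComplexity Filter
open scoped NNReal

/-- The Literature module's COR-vertex `corVec` (p615264) and this seat's earlier verbatim copy `corVertex` of the line
workfile agree (the two spell the Boolean tests as `b u` / `b u && b v` resp. `b u = true` / `b u = true ∧ b v = true`).
[bookkeeping] -/
theorem corVec_eq_corVertex {V : Type} [DecidableEq V] (G : SimpleGraph V) [DecidableRel G.Adj] (b : V → Bool) :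
    Literature.Combinatorics.Optimization.corVec G b = corVertex G b := by
  funext p
  simp only [Literature.Combinatorics.Optimization.corVec, corVertex, Bool.and_eq_true]

/-- Hence the two correlation polytopes `corPolytopeGraph` (Literature) and `QueueGridFace.corPolytopeGraph` agree.
[bookkeeping] -/
theorem corPolytopeGraph_eq {V : Type} [DecidableEq V] (G : SimpleGraph V) [DecidableRel G.Adj] :
    Literature.Combinatorics.Optimization.corPolytopeGraph G = corPolytopeGraph G := by
  unfold Literature.Combinatorics.Optimization.corPolytopeGraph corPolytopeGraph
  rw [show Literature.Combinatorics.Optimization.corVec G = corVertex G from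
    funext (corVec_eq_corVertex G)]

/-- **Input (B) of the K1 line from the print fact.**  `QueueGridPPHard` (its body, over the Theorems-side
`queueGridPP`) follows from Aboulker–Fiorini–Huynh–Macchia–Seif 2019 (Theorem 6 / remark p. 4, as typed in
`Literature.Combinatorics.Optimization.AboulkerEtAl2019_corGridMinor`) through its grid instance `.grid` and the glue
`queueGridPPHard_of_corGridBound`. [assembly; cite: AboulkerEtAl2019, Thm 6] -/
theorem queueGridPPHard_of_AboulkerEtAl2019
    (hyp : Literature.Combinatorics.Optimization.AboulkerEtAl2019_corGridMinor) :
    ∀ c : ℕ, ∃ r₀ : ℕ, ∀ r ≥ r₀, ∀ t : ℕ, HasEFOfSize (queueGridPP r) t → 2 ^ ((Nat.log 2 r + c) ^ c) < t := by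
  obtain ⟨c, hc, t₀, H⟩ := Literature.Combinatorics.Optimization.AboulkerEtAl2019_corGridMinor.grid hyp
  refine queueGridPPHard_of_corGridBound ⟨c, hc, Filter.eventually_atTop.2 ⟨t₀, fun t ht R hR => H t ht R ?_⟩⟩
  rwa [corPolytopeGraph_eq]

/-- **The body of K1 conditional on the print fact and input (A).**  [assembly] -/
theorem newtXC_of_faceProjection_of_AboulkerEtAl2019
    (hF : ∀ r n : ℕ, 1 ≤ r → (r + 1) * (2 * r + 1) ≤ n →
      ∃ (k : ℕ) (cv : Fin k → (Fin (2 * n) × Fin (2 * n) → ℝ)) (δ : Fin k → ℝ)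
        (f : (QGV r × QGV r) × Bool × Bool → Fin (2 * n) × Fin (2 * n)),
        (fun x : (Fin (2 * n) × Fin (2 * n)) → ℝ => x ∘ f) ''
            (newt (Literature.Computability.AlgebraicComplexity.nestFreeMatchingPoly n ℝ≥0) ∩
              {x | ∀ t, cv t ⬝ᵥ x = δ t}) = queueGridPP r)
    (hyp : Literature.Combinatorics.Optimization.AboulkerEtAl2019_corGridMinor) :
    ∀ c : ℕ, ∃ n₀ : ℕ, ∀ n ≥ n₀, ∀ r : ℕ,
      HasEFOfSize (newt (Literature.Computability.AlgebraicComplexity.nestFreeMatchingPoly n ℝ≥0)) r →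
        2 ^ ((Nat.log 2 n + c) ^ c) < r :=
  newtXC_of_inputs hF (queueGridPPHard_of_AboulkerEtAl2019 hyp)

end Summit.ValiantsHypothesis.ValiantsHypothesis.Theorems.FifoMatching.QueueGridFace
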